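import Summits.CriticalPhenomena.Ising3DConformalLimit.Theorems.EnergyNotSigmaSquaredMoebiusLimitExistsDefs
import Summits.CriticalPhenomena.Ising3DConformalLimit.Theorems.EnergyNotSigmaSquaredMoebiusLimitExistsLocallyBounded
import Literature.Probability.LatticeModels.CriticalWickDichotomy
import Literature.Probability.LatticeModels.CriticalUrsellFourSign
import Literature.Probability.LatticeModels.GaussianPairingBound
import HarnessLib

/-!
# Correlation inequalities inherited by the cluster points of the pinned zoom
(line `only-interaction-breaks-moebius` of the crux `MoebiusLimitExists`, item stmt-CriticalPhenomena-1344;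
registered sub-goals `clusterPoint_limitConnectedFour_nonpos`, `clusterPoint_abs_sub_pairingSum_le`,
`clusterPoint_le_pairingSum`)

A cluster point `S` of the pinned zoom of the critical `ℤ³` spin correlators (`IsClusterPoint S`:
locally uniform limits, off the diagonals, of `ρ_pin(u_k)ⁿ ⟨σ_{[x₁/u_k]} ⋯ σ_{[xₙ/u_k]}⟩_{β_c}` along ONE
mesh sequence `u_k → 0⁺`, for every order `n` at once) inherits the classical correlation
inequalities of the lattice model. This file is the toolkit for the interacting stratum of the line:

* `clusterPoint_limitConnectedFour_nonpos` — **Lebowitz in the limit**: `U₄^S(z) ≤ 0` at every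
  non-coincident quadruple (`U₄^S = limitConnectedFour S`); sequential form of the tree theorem
  `limitConnectedFour_nonpos_of_hasPointwiseScalingLimit` (`criticalUrsellFour_nonpos`, `ρ⁴ ≥ 0`).
* `clusterPoint_abs_sub_pairingSum_le` — **Aizenman's Proposition 12.1 in the limit** ("almost free
  ⇒ almost Wick"): for `m ≥ 2` and `x` non-coincident,
  `|S_{2m}(x) − 𝒢_m[S₂](x)| ≤ (3/2) R_{2m}[S₂, U₄^S](x)`, `S₂(p,q) = S 2 ![p,q]`, `𝒢_m = pairingSum`,
  `R_{2m} = wickRemainder`; the quantitative form of the landed `stub_freeClusterPointWick`.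
* `clusterPoint_le_pairingSum` — **Griffiths I and Newman's Gaussian inequality in the limit**:
  `0 ≤ S_{2m}(x) ≤ 𝒢_m[S₂](x)` for every `m` and every non-coincident `x`.

Technique (as in `CriticalWickDichotomy`, with the filter `𝓝[>] 0` replaced by `atTop` along the mesh
sequence): the infinite-volume lattice inequalities (`abs_criticalCorr_sub_pairingSum_le`,
`criticalCorr_le_pairingSum`, `criticalCorr_nonneg'`, `criticalUrsellFour_nonpos`) are rescaled by
`ρ_pin(u_k)^{2m} = (ρ_pin²)ᵐ ≥ 0` at the lattice points `[xᵢ/u_k]`, rewritten at the level of INDICES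
(`PairIsing.pairingSum_eq_pow_mul`, `wickRemainder_eq_pow_mul_of_ne`: pairings and `4`-subsets only read
distinct indices, so diagonal / non-injective entries may be set to `0`), and passed to the limit
`k → ∞` (`tendsto_pairingSum`, `tendsto_wickRemainder`) using the convergence of the rescaled two- and
four-point data at non-coincident configurations only (`tendsto_rescaledUrsellFour_clusterSeq`). Only
the convergence clauses of `IsClusterPoint` are used (the mesh sequence need not tend to `0`). No
definitions are introduced.

References: J. L. Lebowitz, Comm. Math. Phys. 35 (1974) 87–92, Theorem, (2.5b) [Lebowitz1974];
M. Aizenman, Comm. Math. Phys. 86 (1982) 1–48, Prop. 12.1, eq. (12.3) [AizenmanCMP1982];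
M. Aizenman, *A geometric perspective on the scaling limits of critical Ising and `φ⁴_d` models*,
CDM 2020 (arXiv:2112.04248), Prop. 7.1–7.2, §10.1 [AizenmanCDM2020]; M. Aizenman, H. Duminil-Copin,
Ann. Math. 194 (2021), arXiv:1912.07973 §6.3 first display (Newman's Gaussian inequality)
[AizenmanDuminilCopinAnnals2021]; S. Friedli, Y. Velenik (CUP 2017), Thm. 3.20 (GKS I)
[FriedliVelenik2017].
-/

noncomputable section

open Filter Topology Set Function
open Literature.Probability.LatticeModels

namespace Summit.CriticalPhenomena.Ising3DConformalLimit.MoebiusLimitExistsOnlyInteraction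

/-! ### Sequential limits of the rescaled lattice data -/

/-- Along a mesh sequence `u_k`, the rescaled lattice Ursell function `ρ(u_k)⁴ U₄([x/u_k])` converges
to `U₄^S(x) = limitConnectedFour S x` as soon as the rescaled `2`- and `4`-point critical correlators
converge to `S` at non-coincident configurations along `u_k` (sequential form of the tree's
`tendsto_rescaled_criticalUrsellFour`; any renormalisation `ρ`). [cite: AizenmanCDM2020, §10.1 eqs. (10.1)–(10.2)] -/
theorem tendsto_rescaledUrsellFour_clusterSeq {u : ℕ → ℝ} {ρ : ℝ → ℝ} {S : CorrFamily 3}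
    (hconv : ∀ n, TendstoLocallyUniformlyOn
      (fun k => rescaledCorrelator (criticalCorr 3) ρ n (u k)) (S n) atTop (NonCoincident 3 n))
    {x : Fin 4 → EuclideanSpace ℝ (Fin 3)} (hx : x ∈ NonCoincident 3 4) :
    Tendsto (fun k => ρ (u k) ^ 4 * (criticalCorr 3 4 (fun i => latticeApprox (u k) (x i)) -
      (criticalCorr 3 2 ![latticeApprox (u k) (x 0), latticeApprox (u k) (x 1)] *
          criticalCorr 3 2 ![latticeApprox (u k) (x 2), latticeApprox (u k) (x 3)]
        + criticalCorr 3 2 ![latticeApprox (u k) (x 0), latticeApprox (u k) (x 2)] *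
          criticalCorr 3 2 ![latticeApprox (u k) (x 1), latticeApprox (u k) (x 3)]
        + criticalCorr 3 2 ![latticeApprox (u k) (x 0), latticeApprox (u k) (x 3)] *
          criticalCorr 3 2 ![latticeApprox (u k) (x 1), latticeApprox (u k) (x 2)]))) atTop
      (𝓝 (limitConnectedFour S x)) := by
  -- adapted from `tendsto_rescaled_criticalUrsellFour` (CriticalUrsellFourSign), filter `atTop`
  have hinj : Function.Injective x := hx
  have hpair : ∀ i j, i ≠ j → Tendsto
      (fun k => ρ (u k) ^ 2 *
        criticalCorr 3 2 ![latticeApprox (u k) (x i), latticeApprox (u k) (x j)])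
      atTop (𝓝 (S 2 ![x i, x j])) := by
    intro i j hij
    have hmem : (![x i, x j] : Fin 2 → EuclideanSpace ℝ (Fin 3)) ∈ NonCoincident 3 2 :=
      pair_mem_nonCoincident fun h => hij (hinj h)
    refine Tendsto.congr (fun k => ?_) ((hconv 2).tendsto_at hmem)
    show rescaledCorrelator (criticalCorr 3) ρ 2 (u k) ![x i, x j] = _
    rw [rescaledCorrelator_apply, latticeApprox_comp_two]
    rfl
  have h4 : Tendsto (fun k => ρ (u k) ^ 4 * criticalCorr 3 4 (fun i => latticeApprox (u k) (x i)))
      atTop (𝓝 (S 4 x)) := (hconv 4).tendsto_at hx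
  have h := h4.sub ((((hpair 0 1 (by decide)).mul (hpair 2 3 (by decide))).add
    ((hpair 0 2 (by decide)).mul (hpair 1 3 (by decide)))).add
    ((hpair 0 3 (by decide)).mul (hpair 1 2 (by decide))))
  have hlim_eq : limitConnectedFour S x = S 4 x - (S 2 ![x 0, x 1] * S 2 ![x 2, x 3]
      + S 2 ![x 0, x 2] * S 2 ![x 1, x 3] + S 2 ![x 0, x 3] * S 2 ![x 1, x 2]) := rfl
  rw [hlim_eq]
  refine Tendsto.congr (fun k => ?_) h
  ring

/-! ### Lebowitz' inequality in the limit -/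

/-- **Registered sub-goal `clusterPoint_limitConnectedFour_nonpos` — Lebowitz' inequality for cluster
points of the pinned zoom.** For every cluster point `S` of the pinned zoom of the critical `ℤ³`
correlators and every non-coincident quadruple `z`, `U₄^S(z) = limitConnectedFour S z ≤ 0`: the
lattice inequality `U₄ ≤ 0` for the critical state (`criticalUrsellFour_nonpos`, box limit of
Lebowitz 1974) multiplied by `ρ_pin(u_k)⁴ ≥ 0` passes to the limit `k → ∞`
(`tendsto_rescaledUrsellFour_clusterSeq`). [cite: Lebowitz1974, Theorem, eq. (2.5b)] [cite: AizenmanCMP1982, §1 and Prop. 12.1] -/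
theorem clusterPoint_limitConnectedFour_nonpos :
    ∀ S : CorrFamily 3, IsClusterPoint S → ∀ z ∈ NonCoincident 3 4, limitConnectedFour S z ≤ 0 := by
  intro S hS z hz
  obtain ⟨u, -, hconv⟩ := hS
  refine le_of_tendsto (tendsto_rescaledUrsellFour_clusterSeq hconv hz)
    (Filter.Eventually.of_forall fun k => ?_)
  have h4 : (0 : ℝ) ≤ rhoPin (u k) ^ 4 := by positivity
  exact mul_nonpos_of_nonneg_of_nonpos h4 (criticalUrsellFour_nonpos (d := 3) le_rfl _)

/-! ### Aizenman's Proposition 12.1 in the limit -/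

/-- **Registered sub-goal `clusterPoint_abs_sub_pairingSum_le` — "almost free ⇒ almost Wick" for
cluster points of the pinned zoom** (Aizenman 1982, Prop. 12.1, passed to the limit along the mesh
sequence): for a cluster point `S`, `m ≥ 2` and `x` non-coincident,
`|S_{2m}(x) − 𝒢_m[S₂](x)| ≤ (3/2) Σ_{4-subsets t} |U₄^S(x_t)| 𝒢_{m-2}[S₂](x_{tᶜ})` with
`S₂(p,q) = S 2 ![p,q]` and `U₄^S = limitConnectedFour S`. The lattice inequality
`abs_criticalCorr_sub_pairingSum_le` is rescaled by `ρ_pin(u_k)^{2m} = (ρ_pin²)ᵐ ≥ 0`, read at the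
level of indices (`PairIsing.pairingSum_eq_pow_mul`, `wickRemainder_eq_pow_mul_of_ne`), and both sides
converge (`tendsto_pairingSum`, `tendsto_wickRemainder`, `tendsto_rescaledUrsellFour_clusterSeq`).
[cite: AizenmanCMP1982, Prop. 12.1, eq. (12.3)] [cite: AizenmanCDM2020, §7, Prop. 7.2, eq. (7.1) and the remark following it (p. 23)] -/
theorem clusterPoint_abs_sub_pairingSum_le :
    ∀ S : CorrFamily 3, IsClusterPoint S → ∀ m : ℕ, 2 ≤ m → ∀ x ∈ NonCoincident 3 (2 * m),
      |S (2 * m) x - pairingSum (fun p q => S 2 ![p, q]) m x| ≤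
        3 / 2 * wickRemainder (fun p q => S 2 ![p, q]) (fun u => limitConnectedFour S u) m x := by
  intro S hS m hm x hx
  obtain ⟨u, -, hconv⟩ := hS
  classical
  -- adapted from `HasPointwiseScalingLimit.eq_pairingSum_of_limitConnectedFour_eq_zero`, steps (1)–(4),
  -- along the mesh sequence and WITHOUT the hypothesis `U₄ ≡ 0`
  have hd : 3 ≤ 3 := le_rfl
  have hinj : Function.Injective x := hx
  -- lattice data at mesh `u k`, read at the level of INDICES (diagonal / non-injective entries zeroed)
  set C2 : Site 3 → Site 3 → ℝ := fun a b => criticalCorr 3 2 ![a, b]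
  set U4c : (Fin 4 → Site 3) → ℝ := fun w => criticalCorr 3 4 w - (C2 (w 0) (w 1) * C2 (w 2) (w 3)
      + C2 (w 0) (w 2) * C2 (w 1) (w 3) + C2 (w 0) (w 3) * C2 (w 1) (w 2))
  set z : ℕ → Fin (2 * m) → Site 3 := fun k i => latticeApprox (u k) (x i)
  set T : ℕ → Fin (2 * m) → Fin (2 * m) → ℝ := fun k i j =>
      if i = j then 0 else rhoPin (u k) ^ 2 * C2 (z k i) (z k j) with hT
  set T₀ : Fin (2 * m) → Fin (2 * m) → ℝ := fun i j => if i = j then 0 else S 2 ![x i, x j] with hT₀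
  set V : ℕ → (Fin 4 → Fin (2 * m)) → ℝ := fun k e =>
      if Function.Injective e then rhoPin (u k) ^ 4 * U4c (z k ∘ e) else 0 with hV
  set V₀ : (Fin 4 → Fin (2 * m)) → ℝ := fun e =>
      if Function.Injective e then limitConnectedFour S (x ∘ e) else 0 with hV₀
  -- (1) index-level rescaling identities
  have hP : ∀ k, pairingSum (T k) m id = (rhoPin (u k) ^ 2) ^ m * pairingSum C2 m (z k) := fun k =>
    PairIsing.pairingSum_eq_pow_mul C2 (T k) (rhoPin (u k) ^ 2) m (z k) id fun i j hij => by
      simp only [hT, id, if_neg hij]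
  have hR : ∀ k, wickRemainder (T k) (V k) m id =
      (rhoPin (u k) ^ 2) ^ m * wickRemainder C2 U4c m (z k) :=
    fun k => wickRemainder_eq_pow_mul_of_ne C2 (T k) U4c (V k) (rhoPin (u k) ^ 2) hm (z k) id
      (fun i j hij => by simp only [hT, id, if_neg hij])
      (fun e he => by
        simp only [hV, Function.id_comp, if_pos he]
        ring)
  -- (2) the rescaled lattice inequality at mesh `u k`
  have hineq : ∀ k, |rhoPin (u k) ^ (2 * m) * criticalCorr 3 (2 * m) (z k) - pairingSum (T k) m id| ≤
      3 / 2 * wickRemainder (T k) (V k) m id := by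
    intro k
    have h : |criticalCorr 3 (2 * m) (z k) - pairingSum C2 m (z k)| ≤
        3 / 2 * wickRemainder C2 U4c m (z k) := abs_criticalCorr_sub_pairingSum_le hd hm (z k)
    have hc : 0 ≤ (rhoPin (u k) ^ 2) ^ m := by positivity
    rw [hP, hR, pow_mul, ← mul_sub, abs_mul, abs_of_nonneg hc]
    calc (rhoPin (u k) ^ 2) ^ m * |criticalCorr 3 (2 * m) (z k) - pairingSum C2 m (z k)|
        ≤ (rhoPin (u k) ^ 2) ^ m * (3 / 2 * wickRemainder C2 U4c m (z k)) :=
          mul_le_mul_of_nonneg_left h hc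
      _ = 3 / 2 * ((rhoPin (u k) ^ 2) ^ m * wickRemainder C2 U4c m (z k)) := by ring
  -- (3) limits along `k → ∞`
  have hpair : ∀ i j, i ≠ j → Tendsto (fun k => rhoPin (u k) ^ 2 * C2 (z k i) (z k j)) atTop
      (𝓝 (S 2 ![x i, x j])) := by
    intro i j hij
    have hmem : (![x i, x j] : Fin 2 → EuclideanSpace ℝ (Fin 3)) ∈ NonCoincident 3 2 :=
      pair_mem_nonCoincident fun h => hij (hinj h)
    refine Tendsto.congr (fun k => ?_) ((hconv 2).tendsto_at hmem)
    show rescaledCorrelator (criticalCorr 3) rhoPin 2 (u k) ![x i, x j] = _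
    rw [rescaledCorrelator_apply, latticeApprox_comp_two]
    rfl
  have hTlim : ∀ i j, Tendsto (fun k => T k i j) atTop (𝓝 (T₀ i j)) := by
    intro i j
    by_cases hij : i = j
    · simp only [hT, hT₀, if_pos hij]
      exact tendsto_const_nhds
    · simp only [hT, hT₀, if_neg hij]
      exact hpair i j hij
  have hVlim : ∀ e : Fin 4 → Fin (2 * m), Tendsto (fun k => V k e) atTop (𝓝 (V₀ e)) := by
    intro e
    by_cases he : Function.Injective e
    · simp only [hV, hV₀, if_pos he]
      have hxe : (x ∘ e) ∈ NonCoincident 3 4 := hinj.comp he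
      exact tendsto_rescaledUrsellFour_clusterSeq hconv hxe
    · simp only [hV, hV₀, if_neg he]
      exact tendsto_const_nhds
  have hL : Tendsto
      (fun k => rhoPin (u k) ^ (2 * m) * criticalCorr 3 (2 * m) (z k) - pairingSum (T k) m id)
      atTop (𝓝 (S (2 * m) x - pairingSum T₀ m id)) :=
    ((hconv (2 * m)).tendsto_at hx).sub (tendsto_pairingSum hTlim m id)
  have hRlim : Tendsto (fun k => 3 / 2 * wickRemainder (T k) (V k) m id) atTop
      (𝓝 (3 / 2 * wickRemainder T₀ V₀ m id)) :=
    Tendsto.const_mul _ (tendsto_wickRemainder hTlim hVlim m id)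
  have hle : |S (2 * m) x - pairingSum T₀ m id| ≤ 3 / 2 * wickRemainder T₀ V₀ m id :=
    le_of_tendsto_of_tendsto hL.abs hRlim (Filter.Eventually.of_forall hineq)
  -- (4) back to the point-level functionals (`s = 1`)
  have hP₀ : pairingSum T₀ m id = (1 : ℝ) ^ m * pairingSum (fun p q => S 2 ![p, q]) m x :=
    PairIsing.pairingSum_eq_pow_mul (fun p q => S 2 ![p, q]) T₀ 1 m x id fun i j hij => by
      simp only [hT₀, id, if_neg hij, one_mul]
  have hR₀ : wickRemainder T₀ V₀ m id =
      (1 : ℝ) ^ m * wickRemainder (fun p q => S 2 ![p, q]) (fun w => limitConnectedFour S w) m x :=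
    wickRemainder_eq_pow_mul_of_ne (fun p q => S 2 ![p, q]) T₀ (fun w => limitConnectedFour S w) V₀ 1
      hm x id (fun i j hij => by simp only [hT₀, id, if_neg hij, one_mul])
      (fun e he => by simp only [hV₀, Function.id_comp, if_pos he, one_pow, one_mul])
  rw [hP₀, hR₀, one_pow, one_mul, one_mul] at hle
  exact hle

/-! ### Griffiths I and Newman's Gaussian inequality in the limit -/

/-- **Registered sub-goal `clusterPoint_le_pairingSum` — `0 ≤ S_{2m} ≤ 𝒢_m[S₂]` for cluster points
of the pinned zoom.** For a cluster point `S`, every `m` and every non-coincident `x : Fin (2m) → ℝ³`,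
`0 ≤ S (2m) x ≤ 𝒢_m[S₂](x)` with `S₂(p,q) = S 2 ![p,q]`. Lower bound: Griffiths' first inequality
in infinite volume (`criticalCorr_nonneg'`) and `ρ_pin^{2m} = (ρ_pin²)ᵐ ≥ 0`, passed to the limit.
Upper bound: Newman's Gaussian inequality for the critical state (`criticalCorr_le_pairingSum`, all
`m`, box limit of `aizenman_nPoint_le_pairingSum_finite_holds`) rescaled at the level of indices
(`PairIsing.pairingSum_eq_pow_mul`) and passed to the limit (`tendsto_pairingSum`).
[cite: FriedliVelenik2017, Thm. 3.20, eq. (3.21)] [cite: AizenmanDuminilCopinAnnals2021, arXiv:1912.07973 §6.3, first display, lower inequality (p. 26)] -/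
theorem clusterPoint_le_pairingSum :
    ∀ S : CorrFamily 3, IsClusterPoint S → ∀ m : ℕ, ∀ x ∈ NonCoincident 3 (2 * m),
      0 ≤ S (2 * m) x ∧ S (2 * m) x ≤ pairingSum (fun p q => S 2 ![p, q]) m x := by
  intro S hS m x hx
  obtain ⟨u, -, hconv⟩ := hS
  classical
  have hinj : Function.Injective x := hx
  -- lattice data at mesh `u k`, read at the level of INDICES (diagonal entries zeroed)
  set C2 : Site 3 → Site 3 → ℝ := fun a b => criticalCorr 3 2 ![a, b]
  set z : ℕ → Fin (2 * m) → Site 3 := fun k i => latticeApprox (u k) (x i)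
  set T : ℕ → Fin (2 * m) → Fin (2 * m) → ℝ := fun k i j =>
      if i = j then 0 else rhoPin (u k) ^ 2 * C2 (z k i) (z k j) with hT
  set T₀ : Fin (2 * m) → Fin (2 * m) → ℝ := fun i j => if i = j then 0 else S 2 ![x i, x j] with hT₀
  have hSlim : Tendsto (fun k => rhoPin (u k) ^ (2 * m) * criticalCorr 3 (2 * m) (z k)) atTop
      (𝓝 (S (2 * m) x)) := (hconv (2 * m)).tendsto_at hx
  have hρ : ∀ k, 0 ≤ rhoPin (u k) ^ (2 * m) := fun k => by
    rw [pow_mul]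
    exact pow_nonneg (sq_nonneg _) m
  refine ⟨ge_of_tendsto hSlim (Filter.Eventually.of_forall fun k =>
    mul_nonneg (hρ k) (Theorems.GapForcesFarMerging.Negative.criticalCorr_nonneg' _)), ?_⟩
  -- (1) index-level rescaling identity
  have hP : ∀ k, pairingSum (T k) m id = (rhoPin (u k) ^ 2) ^ m * pairingSum C2 m (z k) := fun k =>
    PairIsing.pairingSum_eq_pow_mul C2 (T k) (rhoPin (u k) ^ 2) m (z k) id fun i j hij => by
      simp only [hT, id, if_neg hij]
  -- (2) the rescaled lattice inequality at mesh `u k`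
  have hineq : ∀ k, rhoPin (u k) ^ (2 * m) * criticalCorr 3 (2 * m) (z k) ≤ pairingSum (T k) m id := by
    intro k
    rw [hP, pow_mul]
    exact mul_le_mul_of_nonneg_left (criticalCorr_le_pairingSum m (z k)) (pow_nonneg (sq_nonneg _) m)
  -- (3) limits along `k → ∞`
  have hpair : ∀ i j, i ≠ j → Tendsto (fun k => rhoPin (u k) ^ 2 * C2 (z k i) (z k j)) atTop
      (𝓝 (S 2 ![x i, x j])) := by
    intro i j hij
    have hmem : (![x i, x j] : Fin 2 → EuclideanSpace ℝ (Fin 3)) ∈ NonCoincident 3 2 :=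
      pair_mem_nonCoincident fun h => hij (hinj h)
    refine Tendsto.congr (fun k => ?_) ((hconv 2).tendsto_at hmem)
    show rescaledCorrelator (criticalCorr 3) rhoPin 2 (u k) ![x i, x j] = _
    rw [rescaledCorrelator_apply, latticeApprox_comp_two]
    rfl
  have hTlim : ∀ i j, Tendsto (fun k => T k i j) atTop (𝓝 (T₀ i j)) := by
    intro i j
    by_cases hij : i = j
    · simp only [hT, hT₀, if_pos hij]
      exact tendsto_const_nhds
    · simp only [hT, hT₀, if_neg hij]
      exact hpair i j hij
  have hle : S (2 * m) x ≤ pairingSum T₀ m id :=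
    le_of_tendsto_of_tendsto hSlim (tendsto_pairingSum hTlim m id) (Filter.Eventually.of_forall hineq)
  -- (4) back to the point-level pairing functional (`s = 1`)
  have hP₀ : pairingSum T₀ m id = (1 : ℝ) ^ m * pairingSum (fun p q => S 2 ![p, q]) m x :=
    PairIsing.pairingSum_eq_pow_mul (fun p q => S 2 ![p, q]) T₀ 1 m x id fun i j hij => by
      simp only [hT₀, id, if_neg hij, one_mul]
  rw [hP₀, one_pow, one_mul] at hle
  exact hle

end Summit.CriticalPhenomena.Ising3DConformalLimit.MoebiusLimitExistsOnlyInteraction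

end
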